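import Literature.Barriers.ValiantsHypothesis.UniversalDistribution
import Mathlib.Analysis.Complex.Exponential
import Mathlib.Data.Nat.Factorial.Basic
import HarnessLib

/-!
# The universal distribution for the spanning tree problem (CDGM 2022, §5.2–5.3), II: averaging

Second half of the proof of CDGM **Lemma 5.2** (arXiv:2109.06941, §5.2–5.3): averaging the
per-embedding discrepancy bound `4^k (3/4)^{#honoured(π)}` of `UniversalDistribution.lean` over
the random embedding `π`. The paper bounds `Pr[π honours < αn sub-gadgets] ≤ 2^{-Ω(n)}`
(Lemma 5.3: sequential conditional probabilities `≥ β`, a union bound and the entropy estimate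
`binom(n, (1-α)n) ≤ 2^{H(1-α)n}`). Here this is replaced by an exact computation which needs
no conditioning: extend the sum from injective placements of the `4k+2` gadget vertices to ALL
placements `f : GV k → Fin N` (the summand is nonnegative), where it factorises over the `k`
blocks of four vertices,
`Σ_f z^{#honoured(f)} = N² · (N⁴ - (1-z)·|A|²|Aᶜ|²)^k` (`sum_pow_honCount`),
and `|A|²|Aᶜ|² ≥ N⁴/81` for nearly balanced `A` (`sum_pow_honCount_le`, `z = 3/4`). The price
is the normalisation `N^{4k+2} / N^{(4k+2)↓} = e^{O(k²/N)}`, which for `N = 40000·k` is beaten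
by `(323/324)^k`: the resulting discrepancy parameter
`γ = N^{4k+2}(323/324)^k / N^{(4k+2)↓}` (`discGamma`) satisfies
`γ ≤ e · e^{-N/(4·10⁷)}` (`discGamma_le_exp`) — CDGM's `2^{-Ω_c(n)}` with (very) explicit
constants.

* `honCount`, `sum_embedding_le_sum_fun`, the block structure `mkFun`/`funEquivGV`/`HonBlock`,
  `card_filter_honBlock` (`|A|²|Aᶜ|²` honoured blocks, a `Fintype.piFinset` count),
  `sum_pow_honCount`, `sum_pow_honCount_le`.
* `card_GV = 4k+2`, `card_sample = N^{(4k+2)↓}·4^k`, `discGamma`, `discGamma_pos`,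
  `sum_abs_univWeight_pos`.
* **`abs_rectSum_le_discGamma`** (Lemma 5.2, explicit): for `N ≤ 3|A|`, `3|A| ≤ 2N` and every
  rectangle, `|Σ_{τ∈S,θ∈T} w(τ ∪ θ)| ≤ γ · Σ|w|`.
* **`discGamma_le_exp`**: `γ ≤ e·exp(-N/(4·10⁷))` when `k ≥ 1`, `40000k ≤ N < 40000(k+1)`.

## References

* [ChattopadhyayDattaGhosalMukhopadhyay2022] §5.2 (Lemma 5.2), §5.3 (Lemma 5.3 and the proof of
  Lemma 5.2).
-/

noncomputable section

namespace Literature.Barriers.ValiantsHypothesis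

open Literature.Computability.AlgebraicComplexity Finset

variable {k N : ℕ}

/-! ### From embeddings to arbitrary placements -/

/-- The number of sub-gadgets honoured by an arbitrary placement `f` of the gadget vertices
(for an embedding this is the number of `Honoured` sub-gadgets). [cite: ChattopadhyayDattaGhosalMukhopadhyay2022, §5.3, Def. 5.1] -/
def honCount (A : Finset (Fin N)) (f : GV k → Fin N) : ℕ :=
  (univ.filter fun i : Fin k =>
    f (GV.a i false) ∈ A ∧ f (GV.a i true) ∈ A ∧ f (GV.b i false) ∉ A ∧ f (GV.b i true) ∉ A).card

open Classical in
/-- For an embedding, `honCount` counts the honoured sub-gadgets. [cite: ChattopadhyayDattaGhosalMukhopadhyay2022, §5.3, Def. 5.1] -/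
theorem card_filter_honoured (A : Finset (Fin N)) (e : GV k ↪ Fin N) :
    (univ.filter fun i => Honoured e A i).card = honCount A e := by
  unfold honCount
  apply congrArg Finset.card
  ext i
  simp [Honoured]

/-- A nonnegative function summed over embeddings is at most its sum over all maps.
[folklore] -/
theorem sum_embedding_le_sum_fun {α β : Type*} [Fintype α] [Fintype β] [DecidableEq α]
    [DecidableEq β] (φ : (α → β) → ℝ) (hφ : ∀ f, 0 ≤ φ f) :
    ∑ e : α ↪ β, φ e ≤ ∑ f : α → β, φ f := by
  classical
  let ι : (α ↪ β) ↪ (α → β) := ⟨fun e => e, DFunLike.coe_injective⟩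
  calc ∑ e : α ↪ β, φ e = ∑ f ∈ univ.map ι, φ f := by rw [Finset.sum_map]; rfl
    _ ≤ ∑ f : α → β, φ f := Finset.sum_le_sum_of_subset_of_nonneg (subset_univ _) fun f _ _ => hφ f

/-! ### The product structure of placements -/

/-- A placement of the gadget vertices from its sub-gadget blocks `F i : Bool × Bool → Fin N`
(`(false, j) ↦` the place of `a i j`, `(true, j) ↦` the place of `b i j`) and the places `r` of
the two end vertices. [cite: ChattopadhyayDattaGhosalMukhopadhyay2022, §5.2 (the vertex map E)] -/
def mkFun (F : Fin k → (Bool × Bool → Fin N)) (r : Bool → Fin N) : GV k → Fin N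
  | .a i j => F i (false, j)
  | .b i j => F i (true, j)
  | .fin j => r j

/-- Placements correspond bijectively to (blocks, ends). [folklore] -/
def funEquivGV : (Fin k → (Bool × Bool → Fin N)) × (Bool → Fin N) ≃ (GV k → Fin N) where
  toFun p := mkFun p.1 p.2
  invFun f := (fun i q => if q.1 then f (GV.b i q.2) else f (GV.a i q.2), fun j => f (GV.fin j))
  left_inv p := by
    obtain ⟨F, r⟩ := p
    simp only [Prod.mk.injEq]
    refine ⟨?_, rfl⟩
    funext i q
    obtain ⟨q1, q2⟩ := q
    cases q1 <;> rfl
  right_inv f := by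
    funext v
    cases v with
    | a i j => rfl
    | b i j => rfl
    | fin j => rfl

/-- The honour predicate of one block. [cite: ChattopadhyayDattaGhosalMukhopadhyay2022, §5.3, Def. 5.1] -/
def HonBlock (A : Finset (Fin N)) (q : Bool × Bool → Fin N) : Prop :=
  q (false, false) ∈ A ∧ q (false, true) ∈ A ∧ q (true, false) ∉ A ∧ q (true, true) ∉ A

/-- `honCount` of a placement counts the honoured blocks. [folklore] -/
theorem honCount_mkFun (A : Finset (Fin N)) (F : Fin k → (Bool × Bool → Fin N)) (r : Bool → Fin N)
    [DecidablePred (HonBlock A)] :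
    honCount A (mkFun F r) = (univ.filter fun i => HonBlock A (F i)).card := by
  unfold honCount
  apply congrArg Finset.card
  ext i
  simp [HonBlock, mkFun]

/-- The weight `z^{#honoured}` of a placement is a product over the blocks. [folklore] -/
theorem pow_card_filter_eq_prod {ι : Type*} [Fintype ι] (p : ι → Prop) [DecidablePred p] (z : ℝ) :
    z ^ (univ.filter p).card = ∏ i, if p i then z else 1 := by
  rw [Finset.prod_ite, prod_const_one, mul_one, prod_const]

/-- The honoured blocks form a box: `|A|² · |Aᶜ|²` of the `N⁴` blocks are honoured. [cite: ChattopadhyayDattaGhosalMukhopadhyay2022, §5.3 (proof of Lemma 5.3, the binomial count)] -/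
theorem card_filter_honBlock (A : Finset (Fin N)) [DecidablePred (HonBlock A)] :
    (univ.filter fun q : Bool × Bool → Fin N => HonBlock A q).card = A.card ^ 2 * Aᶜ.card ^ 2 := by
  classical
  let t : Bool × Bool → Finset (Fin N) := fun c => if c.1 then Aᶜ else A
  have h : (univ.filter fun q : Bool × Bool → Fin N => HonBlock A q) = Fintype.piFinset t := by
    ext q
    simp only [mem_filter, mem_univ, true_and, Fintype.mem_piFinset, HonBlock, t]
    constructor
    · rintro ⟨h1, h2, h3, h4⟩ ⟨c1, c2⟩
      cases c1 <;> cases c2 <;> simp [h1, h2, h3, h4]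
    · intro h
      refine ⟨by simpa using h (false, false), by simpa using h (false, true), ?_, ?_⟩
      · have := h (true, false); simpa using this
      · have := h (true, true); simpa using this
  rw [h, Fintype.card_piFinset, Fintype.prod_prod_type]
  simp only [Fintype.prod_bool, t]
  simp
  ring

/-- **The sum over all placements factorises** (product measure): 
`Σ_f z^{#honoured(f)} = N² · (N⁴ - (1 - z)|A|²|Aᶜ|²)^k`. [cite: ChattopadhyayDattaGhosalMukhopadhyay2022, §5.3 (Lemma 5.3, replaced by an exact product computation)] -/
theorem sum_pow_honCount (A : Finset (Fin N)) (z : ℝ) :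
    ∑ f : GV k → Fin N, z ^ honCount A f =
      (N : ℝ) ^ 2 * ((N : ℝ) ^ 4 - (1 - z) * (A.card ^ 2 * Aᶜ.card ^ 2 : ℕ)) ^ k := by
  classical
  rw [← funEquivGV.sum_comp, Fintype.sum_prod_type, Finset.sum_comm]
  have hblock : ∑ q : Bool × Bool → Fin N, (if HonBlock A q then z else 1) =
      (N : ℝ) ^ 4 - (1 - z) * (A.card ^ 2 * Aᶜ.card ^ 2 : ℕ) := by
    rw [← Finset.sum_filter_add_sum_filter_not univ (fun q => HonBlock A q)]
    rw [Finset.sum_congr rfl (fun q hq => if_pos (mem_filter.1 hq).2),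
      Finset.sum_congr rfl (fun q hq => if_neg (mem_filter.1 hq).2),
      sum_const, sum_const, nsmul_eq_mul, nsmul_eq_mul, mul_one, card_filter_honBlock]
    have hc : ((univ.filter fun q : Bool × Bool → Fin N => ¬ HonBlock A q).card : ℝ) =
        (N : ℝ) ^ 4 - (A.card ^ 2 * Aᶜ.card ^ 2 : ℕ) := by
      have h1 := Finset.card_filter_add_card_filter_not (s := (univ : Finset (Bool × Bool → Fin N))) (p := fun q => HonBlock A q)
      rw [card_filter_honBlock, card_univ, Fintype.card_fun, Fintype.card_prod, Fintype.card_bool,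
        Fintype.card_fin] at h1
      have h2 : ((univ.filter fun q : Bool × Bool → Fin N => ¬ HonBlock A q).card : ℝ) =
          ((N ^ (2 * 2) : ℕ) : ℝ) - (A.card ^ 2 * Aᶜ.card ^ 2 : ℕ) := by
        rw [eq_sub_iff_add_eq]
        exact_mod_cast (by omega : (univ.filter fun q : Bool × Bool → Fin N => ¬ HonBlock A q).card +
          A.card ^ 2 * Aᶜ.card ^ 2 = N ^ (2 * 2))
      rw [h2]; push_cast; ring
    rw [hc]; ring
  have hinner : ∀ r : Bool → Fin N, ∑ F : Fin k → (Bool × Bool → Fin N), z ^ honCount A (funEquivGV (F, r)) =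
      ((N : ℝ) ^ 4 - (1 - z) * (A.card ^ 2 * Aᶜ.card ^ 2 : ℕ)) ^ k := by
    intro r
    have h1 : ∀ F : Fin k → (Bool × Bool → Fin N), z ^ honCount A (funEquivGV (F, r)) =
        ∏ i, (if HonBlock A (F i) then z else 1) := by
      intro F
      change z ^ honCount A (mkFun F r) = _
      rw [honCount_mkFun, pow_card_filter_eq_prod]
    simp_rw [h1]
    rw [← hblock, ← Fintype.piFinset_univ, ← Finset.prod_univ_sum (fun _ => univ)
      (fun _ q => if HonBlock A q then z else 1), prod_const, card_univ, Fintype.card_fin]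
  simp_rw [hinner]
  rw [sum_const, card_univ, Fintype.card_fun, Fintype.card_bool, Fintype.card_fin, nsmul_eq_mul]
  push_cast
  ring

/-- For a nearly balanced `A` (`N ≤ 3|A|`, `3|A| ≤ 2N`) at least `N⁴/81` blocks are honoured, so
with `z = 3/4`: `Σ_f (3/4)^{#honoured(f)} ≤ N² (N⁴ · 323/324)^k`. [cite: ChattopadhyayDattaGhosalMukhopadhyay2022, §5.3 (Lemma 5.3: "k, t ≥ n'/3 ... at least some constant β > 0")] -/
theorem sum_pow_honCount_le (A : Finset (Fin N)) (hA1 : N ≤ 3 * A.card) (hA2 : 3 * A.card ≤ 2 * N) :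
    ∑ f : GV k → Fin N, (3 / 4 : ℝ) ^ honCount A f ≤
      (N : ℝ) ^ 2 * ((N : ℝ) ^ 4 * (323 / 324)) ^ k := by
  rw [sum_pow_honCount]
  have hc : Aᶜ.card = N - A.card := by rw [Finset.card_compl, Fintype.card_fin]
  have h9 : N ^ 2 ≤ 9 * (A.card * Aᶜ.card) := by
    rw [hc]
    have : N * N ≤ (3 * A.card) * (3 * (N - A.card)) := Nat.mul_le_mul hA1 (by omega)
    nlinarith
  have h81 : (N : ℝ) ^ 4 ≤ 81 * (A.card ^ 2 * Aᶜ.card ^ 2 : ℕ) := by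
    have : N ^ 4 ≤ 81 * (A.card ^ 2 * Aᶜ.card ^ 2) := by
      have := Nat.mul_le_mul h9 h9
      nlinarith
    exact_mod_cast this
  apply mul_le_mul_of_nonneg_left _ (by positivity)
  apply pow_le_pow_left₀
  · have : ((A.card ^ 2 * Aᶜ.card ^ 2 : ℕ) : ℝ) ≤ (N : ℝ) ^ 4 := by
      have h1 : A.card ≤ N := by
        have := A.card_le_univ; rwa [Fintype.card_fin] at this
      have h2 : Aᶜ.card ≤ N := by
        have := Aᶜ.card_le_univ; rwa [Fintype.card_fin] at this
      have : A.card ^ 2 * Aᶜ.card ^ 2 ≤ N ^ 4 := by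
        calc A.card ^ 2 * Aᶜ.card ^ 2 ≤ N ^ 2 * N ^ 2 :=
              Nat.mul_le_mul (Nat.pow_le_pow_left h1 2) (Nat.pow_le_pow_left h2 2)
          _ = N ^ 4 := by ring
      exact_mod_cast this
    nlinarith
  · nlinarith

/-! ### Cardinalities and the discrepancy parameter -/

/-- The gadget has `4k + 2` non-root vertices. [cite: ChattopadhyayDattaGhosalMukhopadhyay2022, §5.1 ("|V| = 4n+2")] -/
theorem card_GV : Fintype.card (GV k) = 4 * k + 2 := by
  have h := Fintype.card_congr (funEquivGV (k := k) (N := 2))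
  rw [Fintype.card_fun, Fintype.card_prod, Fintype.card_fun, Fintype.card_fun, Fintype.card_fun,
    Fintype.card_prod, Fintype.card_bool, Fintype.card_fin, Fintype.card_fin] at h
  -- h : (2 ^ (2*2)) ^ k * 2 ^ 2 = 2 ^ card (GV k)
  have h' : 2 ^ Fintype.card (GV k) = 2 ^ (4 * k + 2) := by
    rw [← h, ← pow_mul, ← pow_add]
  exact Nat.pow_right_injective le_rfl h' 

/-- The number of samples: `Z = N^{(4k+2)↓} · 4^k`. [cite: ChattopadhyayDattaGhosalMukhopadhyay2022, §5.2] -/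
theorem card_sample : Fintype.card (Sample k N) = N.descFactorial (4 * k + 2) * 4 ^ k := by
  rw [Fintype.card_prod, Fintype.card_embedding_eq, card_GV, Fintype.card_fin, Fintype.card_prod,
    Fintype.card_fun, Fintype.card_bool, Fintype.card_fin, ← mul_pow]
  rfl

/-- **The discrepancy parameter** `γ = N^{4k+2} (323/324)^k / N^{(4k+2)↓}` of the universal
distribution (our explicit form of CDGM's `2^{-Ω_c(n)}` in Lemma 5.2).
[cite: ChattopadhyayDattaGhosalMukhopadhyay2022, §5.2, Lemma 5.2] -/
def discGamma (k N : ℕ) : ℝ :=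
  (N : ℝ) ^ (4 * k + 2) * (323 / 324 : ℝ) ^ k / (N.descFactorial (4 * k + 2) : ℝ)

/-- `γ > 0` as soon as the gadget fits. [folklore] -/
theorem discGamma_pos (hN : 4 * k + 2 ≤ N) : 0 < discGamma k N := by
  unfold discGamma
  have h1 : 0 < N.descFactorial (4 * k + 2) := Nat.descFactorial_pos.2 hN
  have h2 : (0 : ℝ) < N := by exact_mod_cast (show 0 < N by omega)
  positivity

/-- The total mass is positive as soon as the gadget fits. [folklore] -/
theorem sum_abs_univWeight_pos (hN : 4 * k + 2 ≤ N) : 0 < ∑ ν, |univWeight k N ν| := by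
  rw [sum_abs_univWeight, card_sample]
  have h1 : 0 < N.descFactorial (4 * k + 2) := Nat.descFactorial_pos.2 hN
  positivity

/-- **Lemma 5.2** (CDGM), explicit form: for every nearly balanced partition and every rectangle,
the rectangle sum of the universal weight is at most `γ · Z`, i.e. `disc_Δ(C^{ST}) ≤ γ`.
[cite: ChattopadhyayDattaGhosalMukhopadhyay2022, §5.2, Lemma 5.2] -/
theorem abs_rectSum_le_discGamma (A : Finset (Fin N)) (hA1 : N ≤ 3 * A.card)
    (hA2 : 3 * A.card ≤ 2 * N) (S : Finset ({i // i ∈ A} → Option (Fin N)))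
    (T : Finset ({i // i ∈ Aᶜ} → Option (Fin N))) :
    |∑ τ ∈ S, ∑ θ ∈ T, univWeight k N ((splitEquiv A).symm (τ, θ))| ≤
      discGamma k N * ∑ ν, |univWeight k N ν| := by
  classical
  refine (abs_rectSum_univWeight_le A S T).trans ?_
  have h1 : ∑ e : GV k ↪ Fin N, (3 / 4 : ℝ) ^ (univ.filter fun i => Honoured e A i).card ≤
      (N : ℝ) ^ 2 * ((N : ℝ) ^ 4 * (323 / 324)) ^ k := by
    calc ∑ e : GV k ↪ Fin N, (3 / 4 : ℝ) ^ (univ.filter fun i => Honoured e A i).card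
        = ∑ e : GV k ↪ Fin N, (3 / 4 : ℝ) ^ honCount A e := by
          refine sum_congr rfl fun e _ => ?_; rw [card_filter_honoured]
      _ ≤ ∑ f : GV k → Fin N, (3 / 4 : ℝ) ^ honCount A f :=
          sum_embedding_le_sum_fun (fun f => (3 / 4 : ℝ) ^ honCount A f) fun f => by positivity
      _ ≤ _ := sum_pow_honCount_le A hA1 hA2
  rw [sum_abs_univWeight, card_sample]
  by_cases hfit : 4 * k + 2 ≤ N
  · have hd : (0 : ℝ) < N.descFactorial (4 * k + 2) := by
      exact_mod_cast Nat.descFactorial_pos.2 hfit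
    have heq : discGamma k N * ((N.descFactorial (4 * k + 2) * 4 ^ k : ℕ) : ℝ) =
        4 ^ k * ((N : ℝ) ^ (4 * k + 2) * (323 / 324 : ℝ) ^ k) := by
      unfold discGamma
      push_cast
      field_simp
    rw [heq]
    apply mul_le_mul_of_nonneg_left _ (by positivity)
    calc ∑ e : GV k ↪ Fin N, (3 / 4 : ℝ) ^ (univ.filter fun i => Honoured e A i).card
        ≤ (N : ℝ) ^ 2 * ((N : ℝ) ^ 4 * (323 / 324)) ^ k := h1
      _ = (N : ℝ) ^ (4 * k + 2) * (323 / 324 : ℝ) ^ k := by ring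
  · -- no embedding exists: the left-hand side vanishes
    have hempty : IsEmpty (GV k ↪ Fin N) := by
      rw [← Fintype.card_eq_zero_iff, Fintype.card_embedding_eq, card_GV, Fintype.card_fin]
      exact Nat.descFactorial_eq_zero_iff_lt.2 (by omega)
    have hsum0 : ∑ e : GV k ↪ Fin N, (3 / 4 : ℝ) ^ (univ.filter fun i => Honoured e A i).card = 0 :=
      Fintype.sum_empty _
    rw [hsum0, mul_zero]
    exact mul_nonneg (by unfold discGamma; positivity) (by positivity)

/-! ### The discrepancy parameter is exponentially small -/

/-- **`γ = 2^{-Ω(N)}`** for `k = ⌊N / 40000⌋ ≥ 1`: explicitly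
`γ ≤ e · exp(-N / (4·10⁷))`. (`N^{(m)↓} ≥ (N-m)^m`, `(1 + m/(N-m))^m ≤ e^{m²/(N-m)}`,
`(323/324)^k ≤ e^{-k/324}`, and `m²/(N-m) ≤ 72k/40000 < k/324` for `m = 4k+2 ≤ 6k`,
`N ≥ 40000k`.) [cite: ChattopadhyayDattaGhosalMukhopadhyay2022, §5.2, Lemma 5.2 ("2^{-Ω_c(n)} where n' = cn")] -/
theorem discGamma_le_exp (hk1 : 1 ≤ k) (hkN : 40000 * k ≤ N) (hNk : N < 40000 * (k + 1)) :
    discGamma k N ≤ Real.exp 1 * Real.exp (-(N : ℝ) / (4 * 10 ^ 7)) := by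
  unfold discGamma
  set m := 4 * k + 2 with hm
  have hm6 : m ≤ 6 * k := by omega
  have hmN : m ≤ N := by omega
  have h2m : 2 * m ≤ N := by omega
  -- real-valued copies of the hypotheses
  set M : ℝ := (m : ℝ) with hM
  set K : ℝ := (k : ℝ) with hK
  set n : ℝ := (N : ℝ) with hn
  have hM6 : M ≤ 6 * K := by rw [hM, hK]; exact_mod_cast hm6
  have hM0 : 0 ≤ M := by positivity
  have hK1 : 1 ≤ K := by rw [hK]; exact_mod_cast hk1
  have hKn : 40000 * K ≤ n := by rw [hK, hn]; exact_mod_cast hkN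
  have hnK : n < 40000 * (K + 1) := by rw [hK, hn]; exact_mod_cast hNk
  have h2M : 2 * M ≤ n := by rw [hM, hn]; exact_mod_cast h2m
  have hnpos : 0 < n := by linarith
  set D : ℝ := ((N - m : ℕ) : ℝ) with hDdef
  have hD_eq : D = n - M := by rw [hDdef, hM, hn, Nat.cast_sub hmN]
  have hD : 0 < D := by rw [hD_eq]; linarith
  -- the denominator
  have hdesc : D ^ m ≤ (N.descFactorial m : ℝ) := by
    have h1 : (N - m) ^ m ≤ N.descFactorial m :=
      le_trans (Nat.pow_le_pow_left (by omega) m) (Nat.pow_sub_le_descFactorial N m)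
    rw [hDdef]; exact_mod_cast h1
  -- the two exponential comparisons
  have hbase1 : n / D ≤ Real.exp (M / D) := by
    have : n / D = M / D + 1 := by
      rw [hD_eq, div_add_one (by linarith : n - M ≠ 0)]; ring
    rw [this]; exact Real.add_one_le_exp _
  have hbase2 : (323 / 324 : ℝ) ≤ Real.exp (-(1 / 324)) := by
    have := Real.one_sub_le_exp_neg (1 / 324 : ℝ)
    norm_num at this ⊢
    exact this
  -- the exponent
  have hMD : M / D ≤ 2 * M / n := by
    rw [div_le_div_iff₀ hD hnpos, hD_eq]; nlinarith
  have hexp1 : M * (M / D) ≤ 72 * K / 40000 := by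
    calc M * (M / D) ≤ M * (2 * M / n) := mul_le_mul_of_nonneg_left hMD hM0
      _ = 2 * M ^ 2 / n := by ring
      _ ≤ 72 * K / 40000 := by
          rw [div_le_div_iff₀ hnpos (by norm_num)]
          have hMsq : M ^ 2 ≤ 36 * K ^ 2 := by nlinarith
          nlinarith
  have hkey : (m : ℝ) * (M / D) + (k : ℝ) * (-(1 / 324)) ≤ 1 + -(N : ℝ) / (4 * 10 ^ 7) := by
    rw [← hM, ← hK, ← hn]
    nlinarith
  -- assemble
  calc (n ^ m * (323 / 324 : ℝ) ^ k) / (N.descFactorial m : ℝ)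
      ≤ (n ^ m * (323 / 324 : ℝ) ^ k) / D ^ m :=
        div_le_div_of_nonneg_left (by positivity) (by positivity) hdesc
    _ = (n / D) ^ m * (323 / 324 : ℝ) ^ k := by rw [div_pow]; ring
    _ ≤ Real.exp (M / D) ^ m * Real.exp (-(1 / 324)) ^ k := by
        apply mul_le_mul (pow_le_pow_left₀ (by positivity) hbase1 m)
          (pow_le_pow_left₀ (by norm_num) hbase2 k) (by positivity) (by positivity)
    _ = Real.exp ((m : ℝ) * (M / D) + (k : ℝ) * (-(1 / 324))) := by
        rw [Real.exp_add, Real.exp_nat_mul, Real.exp_nat_mul]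
    _ ≤ Real.exp (1 + -(N : ℝ) / (4 * 10 ^ 7)) := Real.exp_le_exp.2 hkey
    _ = Real.exp 1 * Real.exp (-(N : ℝ) / (4 * 10 ^ 7)) := Real.exp_add _ _

end Literature.Barriers.ValiantsHypothesis
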